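import Summits.AtomisticToContinuum.FouriersLaw.Theorems.BondHeatUncertaintyBoundedResponseHeatSpreadingB

/-!
# NODE 104 «HeatSpreading» — part C of 3 (sequel of `…HeatSpreadingA` / `…HeatSpreadingB`): §9 the graded door and the 11071 door, §10 necessity, §11 the top of the ladder, §12 the cross-branch seam to (S)

Split for the 400-line cap by the landing lane (hand-2 g38) — 3-way cut A (l.1–305) / B (l.312–558) / C (l.559–776) approved by critic row 1440 (B); same namespace
`…Theorems.BoundedResponse.HeatSpreading` and opens throughout; all FQNs unchanged; bodies verbatim; lane docstrings / private twins announced on the bus.  0 sorry; standard axioms.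
-/

noncomputable section

open MeasureTheory ProbabilityTheory Filter Topology Set Function
open scoped NNReal ENNReal
open Literature.MathematicalPhysics.KineticTheory.HeatConduction
open Literature.MathematicalPhysics.KineticTheory OscillatorChain
open Summit.AtomisticToContinuum.FouriersLaw.Theorems.SubdiffusiveBondHeat
open Summit.AtomisticToContinuum.FouriersLaw.Theorems.SubdiffusiveBondHeat.EscapeGrading
open Summit.AtomisticToContinuum.FouriersLaw.Theorems.OddSectorIrreversibility

namespace Summit.AtomisticToContinuum.FouriersLaw.Theorems.BoundedResponse.HeatSpreading

open Summit.AtomisticToContinuum.FouriersLaw.Theses.BondHeatUncertainty (BoundedResponse SubdiffusiveBondHeat)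
open Summit.AtomisticToContinuum.FouriersLaw.Theorems.BoundedResponse.TransientBand (integral_min_mul_eq_sub)
open Summit.AtomisticToContinuum.FouriersLaw.Theorems.LightConeBondHeat (pinnedChain_autocorr_abs_le)
open Summit.AtomisticToContinuum.FouriersLaw.Theorems.BoundedResponse.TransientContact (gibbsBondHeatVar gibbsBondCorr)
open Summit.AtomisticToContinuum.FouriersLaw.Theorems.BoundedResponse.ParityFloor (exists_integral_totalCurrent_sq_gibbsMeasure_le)

section Ladder

variable {ω₂ lam β γ T : ℝ}

/-- `x ^ (3:ℝ) = x ^ 3` [private twin of part B's private `rpow_three` (invisible across the split), added by the landing lane; statement and body verbatim]. -/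
private theorem rpow_three (x : ℝ) : x ^ (3 : ℝ) = x ^ 3 := by
  rw [show (3 : ℝ) = ((3 : ℕ) : ℝ) by norm_num, Real.rpow_natCast]

/-! ## §9 The graded door and the 11071 door -/

/-- **THE GRADED DOOR: (HSᴾ_h) ∧ (TCᶜ_g) ⟹ `ExponentFloor (4 − max h g)`** — at `t = cN²`, `cN²·G_N = V_N/2 + Tr_N ≤ (|C₁|/2 + |C₂|)·N^{max h g}`,
then `escapeDeficit_le_of_totalGK_le`.  (`h = g = 3`: the Ohmic floor; `h = 5` or `g = 4`: the free rung `F(0)`/`F(−1)`.) [folklore] -/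
theorem exponentFloor_of_heatSpreadPoint_gkTailCeiling {h g : ℝ} (hP : HeatSpreadPoint h) (hC : GKTailCeiling g) :
    ExponentFloor (4 - max h g) := by
  intro ω₂ lam β γ hω hl hβ hγ T hT
  obtain ⟨C₁, c, hc, N₁, h₁⟩ := hP ω₂ lam β γ hω hl hβ hγ T hT
  obtain ⟨C₂, N₂, h₂⟩ := hC ω₂ lam β γ hω hl hβ hγ T hT c hc
  set K : ℝ := |C₁| / 2 + |C₂| with hK
  have hK0 : 0 ≤ K := by positivity
  refine ⟨4 * K / (c * γ * T ^ 2), max N₁ (max N₂ 2), fun N hN => ?_⟩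
  have hNN₁ : N₁ ≤ N := le_trans (le_max_left _ _) hN
  have hNN₂ : N₂ ≤ N := le_trans (le_max_left _ _) (le_trans (le_max_right _ _) hN)
  have hN2 : 2 ≤ N := le_trans (le_max_right _ _) (le_trans (le_max_right _ _) hN)
  have hN1 : (1 : ℝ) ≤ N := by exact_mod_cast (show 1 ≤ N by omega)
  have ht : (0 : ℝ) ≤ c * (N : ℝ) ^ 2 := by positivity
  have hEH := mul_totalGK_eq hω hl hβ hγ hT (show 0 < N by omega) ht
  have hV := h₁ N hNN₁
  have hTr := h₂ N hNN₂
  have hm1 : (N : ℝ) ^ h ≤ (N : ℝ) ^ max h g := Real.rpow_le_rpow_of_exponent_le hN1 (le_max_left _ _)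
  have hm2 : (N : ℝ) ^ g ≤ (N : ℝ) ^ max h g := Real.rpow_le_rpow_of_exponent_le hN1 (le_max_right _ _)
  have hp : 0 ≤ (N : ℝ) ^ max h g := Real.rpow_nonneg (by linarith) _
  have hle : c * (N : ℝ) ^ 2 * totalGK ω₂ lam β γ T N ≤ K * (N : ℝ) ^ max h g := by
    rw [hEH]
    have e1 : C₁ * (N : ℝ) ^ h ≤ |C₁| * (N : ℝ) ^ max h g :=
      (mul_le_mul_of_nonneg_right (le_abs_self C₁) (Real.rpow_nonneg (by linarith) _)).trans
        (mul_le_mul_of_nonneg_left hm1 (abs_nonneg _))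
    have e2 : C₂ * (N : ℝ) ^ g ≤ |C₂| * (N : ℝ) ^ max h g :=
      (mul_le_mul_of_nonneg_right (le_abs_self C₂) (Real.rpow_nonneg (by linarith) _)).trans
        (mul_le_mul_of_nonneg_left hm2 (abs_nonneg _))
    calc heatSpread ω₂ lam β γ T N (c * (N : ℝ) ^ 2) / 2 + gkTail ω₂ lam β γ T N (c * (N : ℝ) ^ 2)
        ≤ C₁ * (N : ℝ) ^ h / 2 + C₂ * (N : ℝ) ^ g := by linarith
      _ ≤ |C₁| * (N : ℝ) ^ max h g / 2 + |C₂| * (N : ℝ) ^ max h g := by linarith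
      _ = K * (N : ℝ) ^ max h g := by rw [hK]; ring
  exact escapeDeficit_le_of_totalGK_le hω hl hβ hγ hT hN2 hK0 hc hle

/-- **THE 11071 DOOR: (HSᴾ_3) ∧ (TCᶜ_3) ⟹ `BoundedResponse`** (`4 − max 3 3 = 1`, `exponentFloor_one_iff_boundedResponse`). [folklore] -/
theorem boundedResponse_of_heatSpreadPoint_gkTailCeiling_three (hP : HeatSpreadPoint 3) (hC : GKTailCeiling 3) :
    BoundedResponse := by
  have h := exponentFloor_of_heatSpreadPoint_gkTailCeiling hP hC
  rw [max_self, show (4 : ℝ) - 3 = 1 by norm_num] at h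
  exact exponentFloor_one_iff_boundedResponse.1 h

/-- **Spreading exponent ⟹ escape exponent: (HSᵂ_b) ∧ (TCᶜ_g) ⟹ `ExponentFloor (4 − max (1+2b) g)`** (normal spreading `b = 1` with the
necessary ceiling `g = 3` lands exactly on the Ohmic floor; `b = 3/2` lands on the free `F(0)`). [folklore] -/
theorem exponentFloor_of_heatSpreadWindow_gkTailCeiling {b g : ℝ} (hW : HeatSpreadWindow b) (hC : GKTailCeiling g) :
    ExponentFloor (4 - max (1 + 2 * b) g) :=
  exponentFloor_of_heatSpreadPoint_gkTailCeiling (heatSpreadPoint_of_window hW) hC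

/-! ## §10 Necessity: the ceiling is free given 11071; the point piece is 11071 modulo the floor -/

/-- **11071 ⟹ (TCᶜ_3)** — `Tr_N(cN²) ≤ cN²·G_N = cN²γT²(N−1)²E_N ≤ cγT²C₁⁺·N³` (`V_N ≥ 0` and the Ohmic floor). [folklore] -/
theorem gkTailCeiling_three_of_boundedResponse (hB : BoundedResponse) : GKTailCeiling 3 := by
  intro ω₂ lam β γ hω hl hβ hγ T hT c hc
  obtain ⟨C₁, N₀, hC₁⟩ := (ohmicFloor_iff_boundedResponse.2 hB) ω₂ lam β γ hω hl hβ hγ T hT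
  refine ⟨c * γ * T ^ 2 * max C₁ 0, max N₀ 2, fun N hN => ?_⟩
  have hNN₀ : N₀ ≤ N := le_trans (le_max_left _ _) hN
  have hN2 : 2 ≤ N := le_trans (le_max_right _ _) hN
  have hNr : (2 : ℝ) ≤ N := by exact_mod_cast hN2
  have hNpos : (0 : ℝ) < N := by linarith
  have ht : (0 : ℝ) ≤ c * (N : ℝ) ^ 2 := by positivity
  have h1 := gkTail_le hω hl hβ hγ hT (show 0 < N by omega) ht
  have hG := totalGK_eq hω hl hβ hγ hT (show 0 < N by omega)
  have hE := hC₁ N hNN₀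
  have hE' : escapeDeficit ω₂ lam β γ T N ≤ max C₁ 0 / (N : ℝ) :=
    hE.trans (div_le_div_of_nonneg_right (le_max_left _ _) hNpos.le)
  have h2 : ((N : ℝ) - 1) ^ 2 * escapeDeficit ω₂ lam β γ T N ≤ max C₁ 0 * (N : ℝ) := by
    have h3 := mul_le_mul_of_nonneg_left hE' (sq_nonneg ((N : ℝ) - 1))
    have h4 : ((N : ℝ) - 1) ^ 2 * (max C₁ 0 / (N : ℝ)) ≤ max C₁ 0 * (N : ℝ) := by
      rw [mul_div_assoc', div_le_iff₀ hNpos]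
      have h5 : ((N : ℝ) - 1) ^ 2 ≤ (N : ℝ) * (N : ℝ) := by nlinarith
      nlinarith [le_max_right C₁ 0]
    exact h3.trans h4
  rw [rpow_three]
  calc gkTail ω₂ lam β γ T N (c * (N : ℝ) ^ 2) ≤ c * (N : ℝ) ^ 2 * totalGK ω₂ lam β γ T N := h1
    _ = c * (N : ℝ) ^ 2 * (γ * T ^ 2) * (((N : ℝ) - 1) ^ 2 * escapeDeficit ω₂ lam β γ T N) := by rw [hG]; ring
    _ ≤ c * (N : ℝ) ^ 2 * (γ * T ^ 2) * (max C₁ 0 * (N : ℝ)) := mul_le_mul_of_nonneg_left h2 (by positivity)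
    _ = c * γ * T ^ 2 * max C₁ 0 * (N : ℝ) ^ 3 := by ring

/-- **11071 ∧ (TFᶜ_3) ⟹ (HSᴾ_3)** — `V_N(N²) = 2(N²G_N − Tr_N(N²)) ≤ 2(γT²C₁⁺ + C)·N³` (window constant `c = 1`).  So (HSᴾ_3) ≡ 11071 modulo
the Green–Kubo tail floor. [folklore] -/
theorem heatSpreadPoint_three_of_boundedResponse_gkTailFloor (hB : BoundedResponse) (hF : GKTailFloor 3) :
    HeatSpreadPoint 3 := by
  intro ω₂ lam β γ hω hl hβ hγ T hT
  obtain ⟨C₁, N₀, hC₁⟩ := (ohmicFloor_iff_boundedResponse.2 hB) ω₂ lam β γ hω hl hβ hγ T hT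
  obtain ⟨C, N₁, hC⟩ := hF ω₂ lam β γ hω hl hβ hγ T hT 1 one_pos
  refine ⟨2 * (γ * T ^ 2 * max C₁ 0 + C), 1, one_pos, max N₀ (max N₁ 2), fun N hN => ?_⟩
  have hNN₀ : N₀ ≤ N := le_trans (le_max_left _ _) hN
  have hNN₁ : N₁ ≤ N := le_trans (le_max_left _ _) (le_trans (le_max_right _ _) hN)
  have hN2 : 2 ≤ N := le_trans (le_max_right _ _) (le_trans (le_max_right _ _) hN)
  have hNr : (2 : ℝ) ≤ N := by exact_mod_cast hN2
  have hNpos : (0 : ℝ) < N := by linarith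
  have ht : (0 : ℝ) ≤ 1 * (N : ℝ) ^ 2 := by positivity
  have hV := heatSpread_eq_two_mul_sub hω hl hβ hγ hT (show 0 < N by omega) ht
  have hG := totalGK_eq hω hl hβ hγ hT (show 0 < N by omega)
  have hTr := hC N hNN₁
  rw [rpow_three] at hTr ⊢
  have hE' : escapeDeficit ω₂ lam β γ T N ≤ max C₁ 0 / (N : ℝ) :=
    (hC₁ N hNN₀).trans (div_le_div_of_nonneg_right (le_max_left _ _) hNpos.le)
  have h2 : (N : ℝ) ^ 2 * ((N : ℝ) - 1) ^ 2 * escapeDeficit ω₂ lam β γ T N ≤ max C₁ 0 * (N : ℝ) ^ 3 := by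
    have h3 := mul_le_mul_of_nonneg_left hE' (show 0 ≤ (N : ℝ) ^ 2 * ((N : ℝ) - 1) ^ 2 by positivity)
    have h4 : (N : ℝ) ^ 2 * ((N : ℝ) - 1) ^ 2 * (max C₁ 0 / (N : ℝ)) ≤ max C₁ 0 * (N : ℝ) ^ 3 := by
      rw [mul_div_assoc', div_le_iff₀ hNpos]
      have h5 : ((N : ℝ) - 1) ^ 2 ≤ (N : ℝ) ^ 2 := by nlinarith
      have h6 : 0 ≤ max C₁ 0 * (N : ℝ) ^ 2 := by positivity
      nlinarith
    exact h3.trans h4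
  calc heatSpread ω₂ lam β γ T N (1 * (N : ℝ) ^ 2)
      = 2 * (1 * (N : ℝ) ^ 2 * totalGK ω₂ lam β γ T N - gkTail ω₂ lam β γ T N (1 * (N : ℝ) ^ 2)) := hV
    _ = 2 * (γ * T ^ 2 * ((N : ℝ) ^ 2 * ((N : ℝ) - 1) ^ 2 * escapeDeficit ω₂ lam β γ T N) -
          gkTail ω₂ lam β γ T N (1 * (N : ℝ) ^ 2)) := by rw [hG]; ring
    _ ≤ 2 * (γ * T ^ 2 * (max C₁ 0 * (N : ℝ) ^ 3) + C * (N : ℝ) ^ 3) := by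
        have := mul_le_mul_of_nonneg_left h2 (show 0 ≤ γ * T ^ 2 by positivity)
        linarith
    _ = 2 * (γ * T ^ 2 * max C₁ 0 + C) * (N : ℝ) ^ 3 := by ring

/-! ## §11 The top of the ladder: uniformly normal spreading ⟹ 11071 (Einstein–Helfand = Green–Kubo, no transient piece) -/

/-- **(HSᵁ) ⟹ 11071** — at fixed `N`, `V_N(t)/(2t) → G_N` (`tendsto_heatSpread_div`), so `V_N(t) ≤ CNt` for all `t ≥ 1` gives
`G_N ≤ CN/2`, i.e. `E_N ≤ (2C⁺/(γT²))/N` for `N ≥ 2`: the Ohmic floor. [folklore] -/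
theorem boundedResponse_of_heatSpreadUniform (hU : HeatSpreadUniform) : BoundedResponse := by
  refine ohmicFloor_iff_boundedResponse.1 fun ω₂ lam β γ hω hl hβ hγ T hT => ?_
  obtain ⟨C, N₀, hC⟩ := hU ω₂ lam β γ hω hl hβ hγ T hT
  refine ⟨2 * max C 0 / (γ * T ^ 2), max N₀ 2, fun N hN => ?_⟩
  have hNN₀ : N₀ ≤ N := le_trans (le_max_left _ _) hN
  have hN2 : 2 ≤ N := le_trans (le_max_right _ _) hN
  have hN0 : 0 < N := by omega
  have hNr : (2 : ℝ) ≤ N := by exact_mod_cast hN2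
  have hNpos : (0 : ℝ) < N := by linarith
  -- `G_N ≤ C N / 2` from the limit
  have hlim := tendsto_heatSpread_div hω hl hβ hγ hT hN0
  have hGle : totalGK ω₂ lam β γ T N ≤ C * (N : ℝ) / 2 := by
    refine le_of_tendsto hlim ?_
    filter_upwards [eventually_ge_atTop (1 : ℝ)] with t ht
    have htpos : (0 : ℝ) < t := by linarith
    rw [div_le_iff₀ (by linarith : (0 : ℝ) < 2 * t)]
    calc heatSpread ω₂ lam β γ T N t ≤ C * (N : ℝ) * t := hC N hNN₀ t ht
      _ = C * (N : ℝ) / 2 * (2 * t) := by ring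
  have hG := totalGK_eq hω hl hβ hγ hT hN0
  have hN1 : (0 : ℝ) < (N : ℝ) - 1 := by linarith
  have hden : 0 < γ * T ^ 2 * ((N : ℝ) - 1) ^ 2 := by positivity
  have hN1' : (N : ℝ) - 1 ≠ 0 := hN1.ne'
  have hγ0 : γ ≠ 0 := hγ.ne'
  have hT0 : T ≠ 0 := hT.ne'
  have hE : escapeDeficit ω₂ lam β γ T N = totalGK ω₂ lam β γ T N / (γ * T ^ 2 * ((N : ℝ) - 1) ^ 2) := by
    rw [hG]; field_simp
  rw [hE, div_le_div_iff₀ hden hNpos]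
  have h1 : C * (N : ℝ) / 2 ≤ max C 0 * (N : ℝ) / 2 := by
    have := mul_le_mul_of_nonneg_right (le_max_left C 0) hNpos.le
    linarith
  have h2 : (N : ℝ) * (N : ℝ) ≤ 4 * ((N : ℝ) - 1) ^ 2 := by nlinarith
  have h3 : 0 ≤ max C 0 := le_max_right _ _
  calc totalGK ω₂ lam β γ T N * (N : ℝ) ≤ max C 0 * (N : ℝ) / 2 * (N : ℝ) :=
        mul_le_mul_of_nonneg_right (hGle.trans h1) hNpos.le
    _ = max C 0 / 2 * ((N : ℝ) * (N : ℝ)) := by ring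
    _ ≤ max C 0 / 2 * (4 * ((N : ℝ) - 1) ^ 2) := mul_le_mul_of_nonneg_left h2 (by positivity)
    _ = 2 * max C 0 / (γ * T ^ 2) * (γ * T ^ 2 * ((N : ℝ) - 1) ^ 2) := by field_simp; ring

/-! ## §12 The cross-branch seam to (S) `SubdiffusiveBondHeat` (9120): given (S) and the telescoping, 11071 ⟺ (TCᶜ_3) -/

/-- **(S) ∧ (TBC) ⟹ (HSᴾ_3)** — at the (S)-bond `b` and `t = cN²` (`cN² ≥ 1`): `V_N(cN²) ≤ 2(N−1)²·A√c·N + C N³ ≤ (2A⁺√c + C⁺)·N³`.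
[folklore] -/
theorem heatSpreadPoint_three_of_subdiffusive_comparison (hS : SubdiffusiveBondHeat) (hT₀ : TotalBondComparison) :
    HeatSpreadPoint 3 := by
  intro ω₂ lam β γ hω hl hβ hγ T hT
  have hS' := hS ω₂ lam β γ hω hl hβ hγ T hT
  simp only [] at hS'
  obtain ⟨A, c, hc, N₀, hA⟩ := hS'
  obtain ⟨C, hC⟩ := hT₀ ω₂ lam β γ hω hl hβ hγ T hT
  obtain ⟨N₁, hN₁⟩ := exists_nat_ge (1 / c)
  refine ⟨2 * max A 0 * Real.sqrt c + max C 0, c, hc, max N₀ (max N₁ 1), fun N hN => ?_⟩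
  have hNN₀ : N₀ ≤ N := le_trans (le_max_left _ _) hN
  have hNN₁ : (N₁ : ℝ) ≤ N := by exact_mod_cast le_trans (le_max_left _ _) (le_trans (le_max_right _ _) hN)
  have hN1 : (1 : ℝ) ≤ N := by exact_mod_cast le_trans (le_max_right _ _) (le_trans (le_max_right _ _) hN)
  have hNpos : (0 : ℝ) < N := by linarith
  have ht1 : (1 : ℝ) ≤ c * (N : ℝ) ^ 2 := by
    have h1 : 1 / c ≤ (N : ℝ) := hN₁.trans hNN₁
    have h2 : 1 ≤ c * (N : ℝ) := by
      rw [div_le_iff₀ hc] at h1; linarith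
    nlinarith
  obtain ⟨b, hb, hVb⟩ := hA N hNN₀
  have hSb := hVb (c * (N : ℝ) ^ 2) ht1 le_rfl
  have hTb := hC N b hb (c * (N : ℝ) ^ 2) (by positivity)
  have hsqrt : Real.sqrt (c * (N : ℝ) ^ 2) = Real.sqrt c * (N : ℝ) := by
    rw [Real.sqrt_mul hc.le, Real.sqrt_sq hNpos.le]
  -- the (S) bound in the `gibbsBondHeatVar` spelling
  have hSb' : gibbsBondHeatVar (pinnedChain ω₂ lam β γ) T N b (c * (N : ℝ) ^ 2) ≤ A * (Real.sqrt c * (N : ℝ)) := by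
    rw [← hsqrt]
    simpa [gibbsBondHeatVar, gibbsBondCorr] using hSb
  rw [rpow_three]
  have hN1sq : ((N : ℝ) - 1) ^ 2 ≤ (N : ℝ) ^ 2 := by nlinarith
  have hA0 : A * (Real.sqrt c * (N : ℝ)) ≤ max A 0 * (Real.sqrt c * (N : ℝ)) :=
    mul_le_mul_of_nonneg_right (le_max_left _ _) (by positivity)
  have hp1 : 0 ≤ max A 0 * (Real.sqrt c * (N : ℝ)) := by positivity
  calc heatSpread ω₂ lam β γ T N (c * (N : ℝ) ^ 2)
      ≤ 2 * ((N : ℝ) - 1) ^ 2 * gibbsBondHeatVar (pinnedChain ω₂ lam β γ) T N b (c * (N : ℝ) ^ 2) + C * (N : ℝ) ^ 3 := hTb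
    _ ≤ 2 * ((N : ℝ) - 1) ^ 2 * (max A 0 * (Real.sqrt c * (N : ℝ))) + max C 0 * (N : ℝ) ^ 3 := by
        have e1 := mul_le_mul_of_nonneg_left (hSb'.trans hA0) (show 0 ≤ 2 * ((N : ℝ) - 1) ^ 2 by positivity)
        have e2 : C * (N : ℝ) ^ 3 ≤ max C 0 * (N : ℝ) ^ 3 := mul_le_mul_of_nonneg_right (le_max_left _ _) (by positivity)
        linarith
    _ ≤ 2 * (N : ℝ) ^ 2 * (max A 0 * (Real.sqrt c * (N : ℝ))) + max C 0 * (N : ℝ) ^ 3 := by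
        have := mul_le_mul_of_nonneg_right (mul_le_mul_of_nonneg_left hN1sq (show (0:ℝ) ≤ 2 by norm_num)) hp1
        linarith
    _ = (2 * max A 0 * Real.sqrt c + max C 0) * (N : ℝ) ^ 3 := by ring

/-- **(S) ∧ (TBC) ∧ (TCᶜ_3) ⟹ 11071** — the heat-spreading door fed by the (S) branch. [folklore] -/
theorem boundedResponse_of_subdiffusive_comparison_gkTailCeiling (hS : SubdiffusiveBondHeat) (hT₀ : TotalBondComparison)
    (hC : GKTailCeiling 3) : BoundedResponse :=
  boundedResponse_of_heatSpreadPoint_gkTailCeiling_three (heatSpreadPoint_three_of_subdiffusive_comparison hS hT₀) hC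

/-- ★ **Given the (S) branch and the fixed-`N` telescoping, the blocker IS the Green–Kubo tail ceiling: (S) → (TBC) → (11071 ⟺ (TCᶜ_3)).**
(⟹ is unconditional: `gkTailCeiling_three_of_boundedResponse`.) [folklore] -/
theorem boundedResponse_iff_gkTailCeiling_three_of_subdiffusive_comparison (hS : SubdiffusiveBondHeat)
    (hT₀ : TotalBondComparison) : BoundedResponse ↔ GKTailCeiling 3 :=
  ⟨gkTailCeiling_three_of_boundedResponse, boundedResponse_of_subdiffusive_comparison_gkTailCeiling hS hT₀⟩

end Ladder

end Summit.AtomisticToContinuum.FouriersLaw.Theorems.BoundedResponse.HeatSpreading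

end
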